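/-
Copyright (c) 2026. Released under the Apache 2.0 license.
-/
import Literature.NumberTheory.EllipticCurves.ManinConstantQuadraticTwistAtTwoProofs
import HarnessLib

/-!
# The twist-covered class certificate WITH THE PRIME `2`: displayed witness
# `TwistSemistableWitnessAtTwo`, class predicate `IsEdixhovenCesnaviciusTwistCoveredTwo`, and
# `ClassAbsManinConstantEqOne` modulo `hM hAU hC hEA hEB hnf`

Topic `Literature/NumberTheory/EllipticCurves`; namespace `Literature.NumberTheory.EllipticCurves.ModularForms`.
Two predicates (definitions; nothing asserted) and their proved consumers; NO named fact.

`ManinConstantClassCertificateTwist.lean` displays, per globally minimal member `W'` and ODD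
square prime `q`, the twist-road witness `TwistSemistableWitnessAt W' q`, and
`ManinConstantClassCertificateTwistGamma0Proofs.lean` proves `ClassAbsManinConstantEqOne W` for
the classes covered at every square prime by Edixhoven's theorem or by such a witness, modulo the
six named inputs `hM hAU hC hEA hEB hnf` (`Γ₀` road). The prime `2` was left out ("`q = 2` is not
treated (Stevens' `η`)"). `ManinConstantQuadraticTwistAtTwoProofs.lean` now proves the per-pair
theorem at `2` (`not_dvd_maninConstant_of_isTwistOfSemistableAtTwo_gamma0`: the class is the
`χ₋₄`/`χ₈`/`χ₋₈`-twist of a class semistable at `2`, with `χ = χ₋₄` or the semistable class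
multiplicative at `2` — the cases `η = 1` of Stevens 1989 Lemma (5.2)). This file packages it:

* `TwistSemistableWitnessAtTwo W'` — the displayed per-member hypothesis at `2`: a parameter
  `d ∈ {−1, 2, −2}` and a globally minimal elliptic `V` with `W' ∼ V.quadraticTwist d`,
  `N(V) ∣ N(W')`, `(4|d|)² ∣ N(W')` (`16` resp. `64`), `4 ∤ N(V)`, `d = −1 ∨ 2 ∣ N(V)`, and `W'`
  additive at `2`. Integer data of the same kind as `TwistSemistableWitnessAt` (two conductors,
  three divisibilities, a reduction type); the witness class is that of Cremona's curve at level
  `N/16`, `N/32`, `N/64` or `N/128`.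
* `not_dvd_maninConstant_of_twistSemistableWitnessAtTwo_gamma0` — `2 ∤ c` for every
  lattice-optimal `X₀`-datum of the member, binders `hM hAU hC2 hnf`.
* `IsEdixhovenCesnaviciusTwistCoveredTwo W` — at every square prime `p` of every globally minimal
  member `W'`: (`p > 7` and `EdixhovenNonexceptionalAt W' p`) or `TwistSemistableWitnessAt W' p`
  or (`p = 2` and `TwistSemistableWitnessAtTwo W'`); `IsEdixhovenCesnaviciusTwistCovered W`
  implies it (`IsEdixhovenCesnaviciusTwistCovered.coveredTwo`).
* `classAbsManinConstantEqOne_of_isEdixhovenCesnaviciusTwistCoveredTwo_gamma0` and the binder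
  form `not_dvd_maninConstant_of_isEdixhovenCesnaviciusTwistCoveredTwo_gamma0` — the class
  certificate, binders `hM hAU hC hEA hEB hnf` (the same six as the odd-prime certificate; the
  Edixhoven facts serve the left disjunct only).

## References
* [Stevens1989] G. Stevens, Invent. Math. 98 (1989), Lemmas (5.2), (5.4).
* [EdixhovenManin1991] B. Edixhoven, Progr. Math. 89 (1991), §1 and Thm. 3.
* [Cesnavicius2018] K. Česnavičius, Compositio Math. 154 (2018), Thm. 1.2.
* [Mazur1978] B. Mazur, Invent. Math. 44 (1978), Cor. 4.1.
* [AbbesUllmo1996] A. Abbes, E. Ullmo, Compositio Math. 103 (1996), Thm. A.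
* [Pal2012] V. Pal, Proc. AMS 140 (2012), Prop. 2.4 (Connell), Prop. 2.5.
-/

noncomputable section

open scoped MatrixGroups ModularForm Classical

open CongruenceSubgroup WeierstrassCurve IsDedekindDomain IsDedekindDomain.HeightOneSpectrum
  NumberField Rat.HeightOneSpectrum Literature.NumberTheory.Automorphic

namespace Literature.NumberTheory.EllipticCurves.ModularForms

/-! ### The per-member hypothesis of the twist road at `2` -/

/-- **"At `2`, the class of `W'` is the `χ₋₄`/`χ₈`/`χ₋₈`-twist of a class semistable at `2`, with
witness and bookkeeping displayed, in a case `η = 1` of Stevens' Lemma (5.2)"** — the hypothesis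
shape of `not_dvd_maninConstant_of_isTwistOfSemistableAtTwo_gamma0`: a parameter
`d ∈ {−1, 2, −2}` (`χ ↔ ℚ(√d)`); a globally minimal elliptic `V` with `W' ∼ V.quadraticTwist d`;
`N(V) ∣ N(W')`; `(4|d|)² ∣ N(W')` (the level condition `m² ∣ N` of the twisting theorem: `16 ∣ N`
for `χ₋₄`, `64 ∣ N` for `χ_{±8}`); `4 ∤ N(V)` (`V` semistable at `2`); `d = −1 ∨ 2 ∣ N(V)`
(`η = 1`: conductor `4`, or `V` multiplicative at `2`); and `W'` additive at `2`. A predicate;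
nothing asserted. [cite: Stevens1989, §5 Lemma (5.2) (the twisting hypothesis, with η)]
[cite: Pal2012, Prop. 2.4 (Connell), case p = 2] -/
def TwistSemistableWitnessAtTwo (W' : WeierstrassCurve ℚ) : Prop :=
  ∃ (d : ℤ) (V : WeierstrassCurve ℚ) (_ : V.IsElliptic) (_ : V.IsGloballyMinimal),
    (d = -1 ∨ d = 2 ∨ d = -2) ∧
    IsIsogenous W' (V.quadraticTwist (d : ℚ)) ∧
    V.conductorNorm ℤ ∣ W'.conductorNorm ℤ ∧ (4 * d.natAbs) ^ 2 ∣ W'.conductorNorm ℤ ∧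
    ¬ 2 ^ 2 ∣ V.conductorNorm ℤ ∧ (d = -1 ∨ 2 ∣ V.conductorNorm ℤ) ∧
    (¬ W'.HasGoodReductionAtPrime 2 ∧ ¬ W'.HasMultiplicativeReductionAtPrime 2)

/-- Unfolding of `TwistSemistableWitnessAtTwo` (by `Iff.rfl`).
[cite: Stevens1989, §5 Lemma (5.2)] -/
theorem twistSemistableWitnessAtTwo_iff (W' : WeierstrassCurve ℚ) :
    TwistSemistableWitnessAtTwo W' ↔
      ∃ (d : ℤ) (V : WeierstrassCurve ℚ) (_ : V.IsElliptic) (_ : V.IsGloballyMinimal),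
        (d = -1 ∨ d = 2 ∨ d = -2) ∧
        IsIsogenous W' (V.quadraticTwist (d : ℚ)) ∧
        V.conductorNorm ℤ ∣ W'.conductorNorm ℤ ∧ (4 * d.natAbs) ^ 2 ∣ W'.conductorNorm ℤ ∧
        ¬ 2 ^ 2 ∣ V.conductorNorm ℤ ∧ (d = -1 ∨ 2 ∣ V.conductorNorm ℤ) ∧
        (¬ W'.HasGoodReductionAtPrime 2 ∧ ¬ W'.HasMultiplicativeReductionAtPrime 2) :=
  Iff.rfl

/-- **Per member, from the displayed witness at `2`**: `TwistSemistableWitnessAtTwo W'` gives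
`2 ∤ D'.maninConstant` for every lattice-optimal `X₀`-datum `D'` of the globally minimal `W'` — on
the `Γ₀` road, binders `hM hAU hC2 hnf` only (`not_dvd_maninConstant_of_isTwistOfSemistableAtTwo_gamma0`
with `W₀ := W'`). [cite: Stevens1989, Lemmas (5.2), (5.4)] [cite: Cesnavicius2018, Thm. 1.2]
[cite: Pal2012, Prop. 2.4 (Connell), case p = 2] -/
theorem not_dvd_maninConstant_of_twistSemistableWitnessAtTwo_gamma0
    (hM : mazur_not_dvd_maninConstant_of_odd)
    (hAU : abbesUllmo_not_dvd_maninConstant_of_not_dvd_level)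
    (hC2 : cesnavicius_not_two_dvd_maninConstant_of_two_dvd_level) (hnf : exists_isNewformOf)
    (W' : WeierstrassCurve ℚ) [W'.IsElliptic] [W'.IsGloballyMinimal] {N' : ℕ} [NeZero N']
    (D' : ModularParametrizationData W' N')
    (hopt : ∀ z ∈ D'.L.lattice, ∃ w ∈ periodLattice D'.f, z = D'.c * w)
    (htw : TwistSemistableWitnessAtTwo W') : ¬ (2 : ℤ) ∣ D'.maninConstant := by
  obtain ⟨d, V, hVE, hVM, hd, hiso, hdvd, hm, h4, hη, hadd⟩ := htw
  haveI := hVE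
  haveI := hVM
  exact not_dvd_maninConstant_of_isTwistOfSemistableAtTwo_gamma0 hM hAU hC2 hnf hd hiso hdvd hm h4
    hη hadd W' D' (IsIsogenous.refl_holds W') hopt

/-! ### The class predicate and the certificate -/

/-- **The "Edixhoven–Česnavičius–twist covered" classes, the prime `2` included**: at every square
prime `p` of the conductor of every globally minimal member `W'` of the class of `W`, either
`p > 7` and `W'` is outside Edixhoven's printed exception (`EdixhovenNonexceptionalAt`), or the odd
twist road applies (`TwistSemistableWitnessAt W' p`), or `p = 2` and the twist road at `2` applies
(`TwistSemistableWitnessAtTwo W'`). A predicate; nothing asserted.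
[cite: EdixhovenManin1991, §1 and Thm. 3] [cite: Cesnavicius2018, Thm. 1.2]
[cite: Stevens1989, §5 Lemma (5.2)] -/
def IsEdixhovenCesnaviciusTwistCoveredTwo (W : WeierstrassCurve ℚ) : Prop :=
  ∀ (W' : WeierstrassCurve ℚ) [W'.IsElliptic] [W'.IsGloballyMinimal], IsIsogenous W W' →
    ∀ (p : ℕ) (hp : p.Prime), p ^ 2 ∣ W'.conductorNorm ℤ →
      (7 < p ∧ EdixhovenNonexceptionalAt W' p hp) ∨
        @TwistSemistableWitnessAt W' p ⟨hp⟩ ∨ (p = 2 ∧ TwistSemistableWitnessAtTwo W')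

/-- Unfolding of `IsEdixhovenCesnaviciusTwistCoveredTwo` (by `Iff.rfl`).
[cite: EdixhovenManin1991, §1 and Thm. 3] -/
theorem isEdixhovenCesnaviciusTwistCoveredTwo_iff (W : WeierstrassCurve ℚ) :
    IsEdixhovenCesnaviciusTwistCoveredTwo W ↔
      ∀ (W' : WeierstrassCurve ℚ) [W'.IsElliptic] [W'.IsGloballyMinimal], IsIsogenous W W' →
        ∀ (p : ℕ) (hp : p.Prime), p ^ 2 ∣ W'.conductorNorm ℤ →
          (7 < p ∧ EdixhovenNonexceptionalAt W' p hp) ∨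
            @TwistSemistableWitnessAt W' p ⟨hp⟩ ∨ (p = 2 ∧ TwistSemistableWitnessAtTwo W') :=
  Iff.rfl

/-- A twist-covered class (odd primes) is twist-covered with the prime `2` included (the first two
disjuncts everywhere). [cite: EdixhovenManin1991, Thm. 3] -/
theorem IsEdixhovenCesnaviciusTwistCovered.coveredTwo {W : WeierstrassCurve ℚ}
    (h : IsEdixhovenCesnaviciusTwistCovered W) : IsEdixhovenCesnaviciusTwistCoveredTwo W :=
  fun W' _ _ hiso p hp hsq ↦ by
    rcases h W' hiso p hp hsq with h1 | h2
    · exact Or.inl h1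
    · exact Or.inr (Or.inl h2)

/-- **Edixhoven 1991 Thm. 3, OR the odd twist road, OR the twist road at `2`, at each square prime;
Česnavičius 2018 Thm. 1.2 at the others — per class, `Γ₀` road, binders `hM hAU hC hEA hEB hnf`.**
If the class of `W` is Edixhoven–Česnavičius–twist covered with the prime `2` included, the Manin
constant of its optimal curve is `±1` (`ClassAbsManinConstantEqOne W`): for an optimal datum `D'`
of a globally minimal member `W'` and a prime `p`, either `p² ∤ N(W')` (Česnavičius), or Edixhoven
(left disjunct: `hEB`/`hEA`), or `not_dvd_maninConstant_of_twistSemistableWitnessAt_gamma0`, or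
(`p = 2`) `not_dvd_maninConstant_of_twistSemistableWitnessAtTwo_gamma0`.
[cite: EdixhovenManin1991, §1 and Thm. 3] [cite: Cesnavicius2018, Thm. 1.2]
[cite: Stevens1989, Lemmas (5.2), (5.4)] [cite: Mazur1978, Cor. 4.1] [cite: AbbesUllmo1996, Thm. A] -/
theorem classAbsManinConstantEqOne_of_isEdixhovenCesnaviciusTwistCoveredTwo_gamma0
    (hM : mazur_not_dvd_maninConstant_of_odd)
    (hAU : abbesUllmo_not_dvd_maninConstant_of_not_dvd_level)
    (hC : cesnavicius_not_two_dvd_maninConstant_of_two_dvd_level)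
    (hEA : edixhoven_not_dvd_maninConstant_of_not_potentiallyGoodOrdinary)
    (hEB : edixhoven_not_dvd_maninConstant_of_kodairaSymbol_ne)
    (hnf : exists_isNewformOf)
    (W : WeierstrassCurve ℚ) (hcov : IsEdixhovenCesnaviciusTwistCoveredTwo W) :
    ClassAbsManinConstantEqOne W := by
  intro W' _ _ N' _ D' hiso hopt
  have hN' : N' = W'.conductorNorm ℤ :=
    IsNewformOf.level_eq_conductorNorm_of_exists_isNewformOf hnf D'.isNewformOf
  subst hN'
  refine D'.abs_maninConstant_eq_one_of_forall_prime_not_dvd fun p hp ↦ ?_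
  by_cases hsq : p ^ 2 ∣ W'.conductorNorm ℤ
  · rcases hcov W' hiso p hp hsq with ⟨h7, hne | hG⟩ | htw | ⟨rfl, htw2⟩
    · exact hEB W' D' hopt p hp h7 hne.1 hne.2.1 hne.2.2
    · exact hEA W' D' hopt p hp h7 hG
    · haveI : Fact p.Prime := ⟨hp⟩
      exact not_dvd_maninConstant_of_twistSemistableWitnessAt_gamma0 hM hAU hC hnf W' D' hopt htw
    · exact_mod_cast
        not_dvd_maninConstant_of_twistSemistableWitnessAtTwo_gamma0 hM hAU hC hnf W' D' hopt htw2
  · exact cesnavicius2018_not_dvd_maninConstant_of_not_sq_dvd_level hM hAU hC W' D' hopt hp hsq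

/-- The binder form carried by consumers (`Γ₀` road, prime `2` included): for a covered class,
`p ∤ c` for EVERY prime `p` and every optimal datum of every globally minimal member, modulo
`hM hAU hC hEA hEB hnf`. [cite: EdixhovenManin1991, §1 and Thm. 3] [cite: Cesnavicius2018, Thm. 1.2] -/
theorem not_dvd_maninConstant_of_isEdixhovenCesnaviciusTwistCoveredTwo_gamma0
    (hM : mazur_not_dvd_maninConstant_of_odd)
    (hAU : abbesUllmo_not_dvd_maninConstant_of_not_dvd_level)
    (hC : cesnavicius_not_two_dvd_maninConstant_of_two_dvd_level)
    (hEA : edixhoven_not_dvd_maninConstant_of_not_potentiallyGoodOrdinary)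
    (hEB : edixhoven_not_dvd_maninConstant_of_kodairaSymbol_ne)
    (hnf : exists_isNewformOf)
    {W : WeierstrassCurve ℚ} (hcov : IsEdixhovenCesnaviciusTwistCoveredTwo W)
    (W' : WeierstrassCurve ℚ) [W'.IsElliptic] [W'.IsGloballyMinimal] {N' : ℕ} [NeZero N']
    (D' : ModularParametrizationData W' N') (hiso : IsIsogenous W W')
    (hopt : ∀ z ∈ D'.L.lattice, ∃ w ∈ periodLattice D'.f, z = D'.c * w)
    (p : ℕ) (hp : p.Prime) : ¬ (p : ℤ) ∣ D'.maninConstant :=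
  (classAbsManinConstantEqOne_of_isEdixhovenCesnaviciusTwistCoveredTwo_gamma0 hM hAU hC hEA hEB hnf
    W hcov).not_dvd_maninConstant D' hiso hopt hp

end Literature.NumberTheory.EllipticCurves.ModularForms

end
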